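import Mathlib
import HarnessLib

/-!
# Peak calculus for the positive viscous Katz–Pavlović chain (helper file under the crux
# `SubOnsagerCeiling.ForwardTailCeilingKP`, stmt-NavierStokesRegularity-27057, `--supports`)

Def-free tools about the RUNNING PEAKS `M_k = max_{[0,s]} Z_k` of an honest solution
`Z_k : [0,s] → ℝ` (`k ≥ -1`, `Z_{-1} ≡ 0`) of the NS-scaled viscous chain
`Ż_k = c₀ (b^{5(k-1)/2} Z_{k-1}² − b^{5k/2} Z_k Z_{k+1}) − ν b^{2k} Z_k` from the one-shell datum
`Z_k(0) = x₀ 1_{k=0}` (the hypotheses are VERBATIM those of the LEAD's chain rungs, e.g.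
`Theorems.VirtualFloor.GapRung.gap_chain10`):

* `deriv_nonneg_of_isMaxOn_Icc` — one-sided Fermat: at a maximiser `t > 0` of `f` on `[0,s]` the
  derivative of `f` within `[0,s]` is `≥ 0`;
* `exists_peak` — every shell attains its maximum on `[0,s]`;
* `peak_ineq` — **the peak inequality**: at a peak time `t⋆` of shell `k ≥ 1` the feed dominates
  drain plus dissipation, `c₀ b^{5k/2} Z_k Z_{k+1} + ν b^{2k} Z_k ≤ c₀ b^{5(k-1)/2} Z_{k-1}²` at `t⋆`;
* `sq_peak_le_of_catchup` — if moreover the next shell has CAUGHT UP to the fraction `ρ` of the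
  peak (`ρ Z_k(t⋆) ≤ Z_{k+1}(t⋆)`), then `b^{5/2} ρ Z_k(t⋆)² ≤ Z_{k-1}(t⋆)²`;
* `datum_sq_le` — the datum shell never exceeds its initial size: `Z_0(t)² ≤ x₀²`;
* `barrier_of_catchup` — **catch-up criterion**: if at some peak time of EVERY shell `k ≥ 1` the
  next shell has caught up to the fraction `b^{2θ-5/2}` of the peak value, then the `θ`-shell barrier
  holds with constant ONE: `(b^θ)^{2k} Z_k(t)² ≤ x₀²` for all `k`, `t`.

Use (census of this hand, memo CHAIN-FRONT-CENSUS-leafhand4-g0.md on the item): along the actual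
one-shell-datum trajectory the catch-up fraction at the peaks is `≈ Λ^{-1/3}` (`Λ = b^{5/2}`) in the
bulk-K41 regime `b ≥ 1.3` and `≈ 0.64–0.79` in the front regime, so the ONE-STEP criterion with
`θ = 101/200` is met for `b ≳ 1.2` and fails below (there the peak of shell `k` occurs after shell
`k-1` has left its own peak, and any proof needs multi-shell memory). Nothing here closes a stub.
HONEST FRAMING: statements about MODEL lattice ODEs (route SubOnsagerCeiling, rung TL-M2Break);
nothing here bears on Navier–Stokes regularity and no crux or summit is proved.
[cite: BarbatoMorandinRomito2011, §2 Lemma 2.1 (the face `Y_n = 1` of the invariant region is the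
static form of the peak inequality)] [cite: Tao2016AveragedNS, §4 (4.13)]
-/

noncomputable section

-- the sub-problem namespace `NavierStokesRegularity.NavierStokesRegularity` is the tree's layout (D-0017)
set_option linter.dupNamespace false

namespace Summit.NavierStokesRegularity.NavierStokesRegularity.Theorems.KPChainPeak

open Set

/-- **One-sided Fermat on `[0,s]`.** If `f` attains its maximum over `[0,s]` at a time `t > 0`
(`t ≤ s`) and has derivative `D` within `[0,s]` at `t`, then `0 ≤ D` (the backward direction `-t`
lies in the positive tangent cone of `[0,s]` at `t`). [folklore; Mathlib `IsLocalMaxOn.hasFDerivWithinAt_nonpos`] -/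
theorem deriv_nonneg_of_isMaxOn_Icc {f : ℝ → ℝ} {D s t : ℝ} (ht0 : 0 < t) (hts : t ≤ s)
    (hmax : IsMaxOn f (Icc 0 s) t) (hder : HasDerivWithinAt f D (Icc 0 s) t) : 0 ≤ D := by
  have hloc : IsLocalMaxOn f (Icc 0 s) t := hmax.localize
  have hy : (-t) ∈ posTangentConeAt (Icc (0 : ℝ) s) t := by
    apply mem_posTangentConeAt_of_segment_subset
    rw [show t + -t = 0 by ring, segment_symm, segment_eq_Icc ht0.le]
    exact Icc_subset_Icc le_rfl hts
  have h := hloc.hasFDerivWithinAt_nonpos hder.hasFDerivWithinAt hy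
  rw [ContinuousLinearMap.toSpanSingleton_apply, smul_eq_mul] at h
  by_contra hD
  push Not at hD
  nlinarith [mul_pos ht0 (neg_pos.mpr hD)]

/-- Every shell of a solution continuous on `[0,s]` (`s ≥ 0`) attains its maximum there.
[folklore; extreme value theorem] -/
theorem exists_peak {s : ℝ} (hs : 0 ≤ s) {Z : ℤ → ℝ → ℝ}
    (hcont : ∀ k : ℕ, ContinuousOn (Z k) (Icc 0 s)) (k : ℕ) :
    ∃ t ∈ Icc (0 : ℝ) s, IsMaxOn (Z k) (Icc 0 s) t :=
  isCompact_Icc.exists_isMaxOn (nonempty_Icc.mpr hs) (hcont k)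

/-- **Peak inequality.** At a peak time `t⋆ ∈ [0,s]` of the shell `k ≥ 1` of the viscous chain from a
one-shell datum, the feed dominates the drain plus the dissipation:
`c₀ b^{5k/2} Z_k(t⋆) Z_{k+1}(t⋆) + ν b^{2k} Z_k(t⋆) ≤ c₀ b^{5(k-1)/2} Z_{k-1}(t⋆)²`
(for `t⋆ > 0` this is one-sided Fermat; for `t⋆ = 0` the shell vanishes there).
[cite: BarbatoMorandinRomito2011, §2 Lemma 2.1 (face `Y_n = 1`)] -/
theorem peak_ineq {b c₀ ν s x₀ : ℝ} (hb : 0 < b) (hc₀ : 0 ≤ c₀) {Z : ℤ → ℝ → ℝ}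
    (hdat : ∀ k : ℤ, Z k 0 = if k = 0 then x₀ else 0)
    (hode : ∀ k : ℕ, ∀ t ∈ Icc 0 s, HasDerivWithinAt (Z k)
      (c₀ * (b ^ ((5 : ℝ) * ((k : ℝ) - 1) / 2) * Z ((k : ℤ) - 1) t ^ 2 -
          b ^ ((5 : ℝ) * (k : ℝ) / 2) * (Z k t * Z ((k : ℤ) + 1) t)) -
        ν * b ^ ((2 : ℝ) * (k : ℝ)) * Z k t) (Icc 0 s) t)
    {k : ℕ} (hk : 1 ≤ k) {t : ℝ} (ht : t ∈ Icc 0 s) (hmax : IsMaxOn (Z k) (Icc 0 s) t) :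
    c₀ * b ^ ((5 : ℝ) * (k : ℝ) / 2) * (Z k t * Z ((k : ℤ) + 1) t) +
        ν * b ^ ((2 : ℝ) * (k : ℝ)) * Z k t ≤
      c₀ * b ^ ((5 : ℝ) * ((k : ℝ) - 1) / 2) * Z ((k : ℤ) - 1) t ^ 2 := by
  rcases ht.1.eq_or_lt with h0 | h0
  · -- the peak is at time 0, where the shell `k ≥ 1` vanishes
    have hz : Z k t = 0 := by
      rw [← h0, hdat]
      have hk0 : k ≠ 0 := by omega
      simp [hk0]
    rw [hz]
    have : 0 ≤ c₀ * b ^ ((5 : ℝ) * ((k : ℝ) - 1) / 2) * Z ((k : ℤ) - 1) t ^ 2 := by positivity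
    simpa using this
  · have := deriv_nonneg_of_isMaxOn_Icc h0 ht.2 hmax (hode k t ht)
    linarith

/-- **One-step contraction under catch-up.** In the situation of `peak_inequality`, with `c₀ > 0`,
`ν ≥ 0`, the peak value non-negative and the next shell caught up to the fraction `ρ` of it
(`ρ Z_k(t⋆) ≤ Z_{k+1}(t⋆)`): `b^{5/2} ρ Z_k(t⋆)² ≤ Z_{k-1}(t⋆)²`. [this file] -/
theorem sq_peak_le_of_catchup {b c₀ ν s x₀ ρ : ℝ} (hb : 0 < b) (hc₀ : 0 < c₀) (hν : 0 ≤ ν)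
    {Z : ℤ → ℝ → ℝ}
    (hdat : ∀ k : ℤ, Z k 0 = if k = 0 then x₀ else 0)
    (hode : ∀ k : ℕ, ∀ t ∈ Icc 0 s, HasDerivWithinAt (Z k)
      (c₀ * (b ^ ((5 : ℝ) * ((k : ℝ) - 1) / 2) * Z ((k : ℤ) - 1) t ^ 2 -
          b ^ ((5 : ℝ) * (k : ℝ) / 2) * (Z k t * Z ((k : ℤ) + 1) t)) -
        ν * b ^ ((2 : ℝ) * (k : ℝ)) * Z k t) (Icc 0 s) t)
    {k : ℕ} (hk : 1 ≤ k) {t : ℝ} (ht : t ∈ Icc 0 s) (hmax : IsMaxOn (Z k) (Icc 0 s) t)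
    (hZk : 0 ≤ Z k t) (hcatch : ρ * Z k t ≤ Z ((k : ℤ) + 1) t) :
    b ^ ((5 : ℝ) / 2) * ρ * Z k t ^ 2 ≤ Z ((k : ℤ) - 1) t ^ 2 := by
  have hpk := peak_ineq hb hc₀.le hdat hode hk ht hmax
  set B : ℝ := b ^ ((5 : ℝ) * ((k : ℝ) - 1) / 2) with hB
  have hBpos : 0 < B := Real.rpow_pos_of_pos hb _
  have hsplit : b ^ ((5 : ℝ) * (k : ℝ) / 2) = B * b ^ ((5 : ℝ) / 2) := by
    rw [hB, ← Real.rpow_add hb]; congr 1; ring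
  have hdiss : 0 ≤ ν * b ^ ((2 : ℝ) * (k : ℝ)) * Z k t := by positivity
  have h1 : c₀ * (B * b ^ ((5 : ℝ) / 2)) * (Z k t * Z ((k : ℤ) + 1) t) ≤ c₀ * B * Z ((k : ℤ) - 1) t ^ 2 := by
    rw [← hsplit]; linarith
  have h2 : Z k t * (ρ * Z k t) ≤ Z k t * Z ((k : ℤ) + 1) t :=
    mul_le_mul_of_nonneg_left hcatch hZk
  have h3 : (c₀ * B) * (b ^ ((5 : ℝ) / 2) * ρ * Z k t ^ 2) ≤ (c₀ * B) * Z ((k : ℤ) - 1) t ^ 2 := by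
    have h52 : 0 ≤ c₀ * (B * b ^ ((5 : ℝ) / 2)) := by positivity
    have := mul_le_mul_of_nonneg_left h2 h52
    nlinarith
  exact le_of_mul_le_mul_left h3 (by positivity)

/-- **The datum shell never exceeds its initial size**: `Z_0(t)² ≤ x₀²` on `[0,s]` (its equation is
`Ż_0 = -(c₀ Z_1 + ν) Z_0` because `Z_{-1} ≡ 0`, and `Z_1 ≥ 0`). [this file] -/
theorem datum_sq_le {b c₀ ν s x₀ : ℝ} (hc₀ : 0 ≤ c₀) (hν : 0 ≤ ν) {Z : ℤ → ℝ → ℝ}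
    (hdat : ∀ k : ℤ, Z k 0 = if k = 0 then x₀ else 0)
    (hvan : ∀ t, Z (-1) t = 0)
    (hcont : ∀ k : ℕ, ContinuousOn (Z k) (Icc 0 s))
    (hode : ∀ k : ℕ, ∀ t ∈ Icc 0 s, HasDerivWithinAt (Z k)
      (c₀ * (b ^ ((5 : ℝ) * ((k : ℝ) - 1) / 2) * Z ((k : ℤ) - 1) t ^ 2 -
          b ^ ((5 : ℝ) * (k : ℝ) / 2) * (Z k t * Z ((k : ℤ) + 1) t)) -
        ν * b ^ ((2 : ℝ) * (k : ℝ)) * Z k t) (Icc 0 s) t)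
    (hnn : ∀ t ∈ Icc 0 s, ∀ k : ℕ, 1 ≤ k → 0 ≤ Z k t) :
    ∀ t ∈ Icc 0 s, Z 0 t ^ 2 ≤ x₀ ^ 2 := by
  intro t ht
  have h00 : Z 0 0 = x₀ := by simpa using hdat 0
  -- the square of the datum shell is antitone on `[0,s]`
  have hanti : AntitoneOn (fun τ => Z 0 τ ^ 2) (Icc 0 s) := by
    apply antitoneOn_of_hasDerivWithinAt_nonpos (convex_Icc 0 s)
      (f' := fun τ => 2 * Z 0 τ * (c₀ * (b ^ ((5 : ℝ) * (((0 : ℕ) : ℝ) - 1) / 2) * Z (((0 : ℕ) : ℤ) - 1) τ ^ 2 -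
          b ^ ((5 : ℝ) * ((0 : ℕ) : ℝ) / 2) * (Z (0 : ℕ) τ * Z (((0 : ℕ) : ℤ) + 1) τ)) -
        ν * b ^ ((2 : ℝ) * ((0 : ℕ) : ℝ)) * Z (0 : ℕ) τ))
    · exact ((hcont 0).fun_pow 2)
    · intro τ hτ
      rw [interior_Icc] at hτ
      have hτ' : τ ∈ Icc 0 s := Ioo_subset_Icc_self hτ
      have hd := (hode 0 τ hτ').mono (interior_subset (s := Icc 0 s))
      rw [interior_Icc] at hd ⊢
      have := hd.fun_pow 2
      simpa [pow_one] using this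
    · intro τ hτ
      rw [interior_Icc] at hτ
      have hτ' : τ ∈ Icc 0 s := Ioo_subset_Icc_self hτ
      have h1 : 0 ≤ Z (((0 : ℕ) : ℤ) + 1) τ := by
        have := hnn τ hτ' 1 le_rfl
        simpa using this
      have hv : Z (((0 : ℕ) : ℤ) - 1) τ = 0 := by
        have := hvan τ; simpa using this
      rw [hv]
      simp only [Nat.cast_zero, mul_zero, zero_div, Real.rpow_zero, ne_eq, OfNat.ofNat_ne_zero,
        not_false_eq_true, zero_pow, one_mul, zero_sub, mul_one]
      have hsq : 0 ≤ Z (0 : ℕ) τ * Z (0 : ℕ) τ := mul_self_nonneg _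
      have hcoef : 0 ≤ (c₀ * Z (((0 : ℕ) : ℤ) + 1) τ + ν) := by positivity
      have key : 2 * Z (0 : ℕ) τ * (c₀ * -(Z (0 : ℕ) τ * Z (((0 : ℕ) : ℤ) + 1) τ) - ν * Z (0 : ℕ) τ) =
          -(2 * ((c₀ * Z (((0 : ℕ) : ℤ) + 1) τ + ν) * (Z (0 : ℕ) τ * Z (0 : ℕ) τ))) := by ring
      have hprod := mul_nonneg hcoef hsq
      have : 2 * Z (0 : ℕ) τ * (c₀ * -(Z (0 : ℕ) τ * Z (((0 : ℕ) : ℤ) + 1) τ) - ν * Z (0 : ℕ) τ) ≤ 0 := by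
        rw [key]; linarith
      simpa using this
  have := hanti (left_mem_Icc.mpr (ht.1.trans ht.2)) ht ht.1
  simpa [h00] using this

/-- **Catch-up criterion for the `θ`-shell barrier with constant one.** If at some peak time of
EVERY shell `k ≥ 1` the next shell has caught up to the fraction `b^{2θ-5/2}` of the peak value,
then `(b^θ)^{2k} Z_k(t)² ≤ x₀²` for every shell `k` and every `t ∈ [0,s]` (induction on `k` with
`sq_peak_le_of_catchup`; base case `datum_sq_le`). For `θ = 101/200` the required fraction is
`b^{-149/100}`. [this file] -/
theorem barrier_of_catchup {b c₀ ν s x₀ θ : ℝ} (hb : 0 < b) (hc₀ : 0 < c₀) (hν : 0 ≤ ν)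
    {Z : ℤ → ℝ → ℝ}
    (hdat : ∀ k : ℤ, Z k 0 = if k = 0 then x₀ else 0)
    (hvan : ∀ t, Z (-1) t = 0)
    (hcont : ∀ k : ℕ, ContinuousOn (Z k) (Icc 0 s))
    (hode : ∀ k : ℕ, ∀ t ∈ Icc 0 s, HasDerivWithinAt (Z k)
      (c₀ * (b ^ ((5 : ℝ) * ((k : ℝ) - 1) / 2) * Z ((k : ℤ) - 1) t ^ 2 -
          b ^ ((5 : ℝ) * (k : ℝ) / 2) * (Z k t * Z ((k : ℤ) + 1) t)) -
        ν * b ^ ((2 : ℝ) * (k : ℝ)) * Z k t) (Icc 0 s) t)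
    (hnn : ∀ t ∈ Icc 0 s, ∀ k : ℕ, 1 ≤ k → 0 ≤ Z k t)
    (hcatch : ∀ k : ℕ, 1 ≤ k → ∃ t ∈ Icc (0 : ℝ) s, IsMaxOn (Z k) (Icc 0 s) t ∧
      b ^ (2 * θ - (5 : ℝ) / 2) * Z k t ≤ Z ((k : ℤ) + 1) t) :
    ∀ k : ℕ, ∀ t ∈ Icc 0 s, (b ^ θ) ^ (2 * k) * Z k t ^ 2 ≤ x₀ ^ 2 := by
  have hbθ : 0 < b ^ θ := Real.rpow_pos_of_pos hb θ
  intro k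
  induction k with
  | zero =>
    intro t ht
    simpa using datum_sq_le hc₀.le hν hdat hvan hcont hode hnn t ht
  | succ k ih =>
    intro t ht
    obtain ⟨tp, htp, hmax, hc⟩ := hcatch (k + 1) (by omega)
    have hZpos : 0 ≤ Z ((k + 1 : ℕ)) tp := hnn tp htp (k + 1) (by omega)
    have hstep := sq_peak_le_of_catchup hb hc₀ hν hdat hode (k := k + 1) (by omega) htp hmax hZpos hc
    -- `b^{5/2} b^{2θ-5/2} = (b^θ)^2`
    have hw : b ^ ((5 : ℝ) / 2) * b ^ (2 * θ - (5 : ℝ) / 2) = (b ^ θ) ^ 2 := by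
      rw [← Real.rpow_add hb, ← Real.rpow_natCast, ← Real.rpow_mul hb.le]
      congr 1; push_cast; ring
    have hprev : (b ^ θ) ^ (2 * k) * Z (((k + 1 : ℕ) : ℤ) - 1) tp ^ 2 ≤ x₀ ^ 2 := by
      have := ih tp htp
      have hcast : (((k + 1 : ℕ) : ℤ) - 1) = ((k : ℕ) : ℤ) := by push_cast; ring
      rw [hcast]; exact this
    -- the value at `t` is below the peak value, both non-negative
    have hle : Z ((k + 1 : ℕ)) t ≤ Z ((k + 1 : ℕ)) tp := hmax ht
    have hZt : 0 ≤ Z ((k + 1 : ℕ)) t := hnn t ht (k + 1) (by omega)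
    have hsq : Z ((k + 1 : ℕ)) t ^ 2 ≤ Z ((k + 1 : ℕ)) tp ^ 2 := by
      exact pow_le_pow_left₀ hZt hle 2
    have hpk : (b ^ θ) ^ 2 * Z ((k + 1 : ℕ)) tp ^ 2 ≤ Z (((k + 1 : ℕ) : ℤ) - 1) tp ^ 2 := by
      rw [← hw]; simpa [mul_assoc] using hstep
    have hpow : (b ^ θ) ^ (2 * (k + 1)) = (b ^ θ) ^ (2 * k) * (b ^ θ) ^ 2 := by
      rw [← pow_add]; ring_nf
    have h2k : 0 ≤ (b ^ θ) ^ (2 * k) := pow_nonneg hbθ.le _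
    calc (b ^ θ) ^ (2 * (k + 1)) * Z ((k + 1 : ℕ)) t ^ 2
        ≤ (b ^ θ) ^ (2 * (k + 1)) * Z ((k + 1 : ℕ)) tp ^ 2 :=
          mul_le_mul_of_nonneg_left hsq (pow_nonneg hbθ.le _)
      _ = (b ^ θ) ^ (2 * k) * ((b ^ θ) ^ 2 * Z ((k + 1 : ℕ)) tp ^ 2) := by rw [hpow]; ring
      _ ≤ (b ^ θ) ^ (2 * k) * Z (((k + 1 : ℕ) : ℤ) - 1) tp ^ 2 :=
          mul_le_mul_of_nonneg_left hpk h2k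
      _ ≤ x₀ ^ 2 := hprev

/-- **Peak identity (interior peaks).** At a peak time `t⋆ ∈ (0,s)` of the shell `k` (two-sided Fermat) the feed
BALANCES the drain plus the dissipation exactly:
`c₀ (b^{5(k-1)/2} Z_{k-1}(t⋆)² − b^{5k/2} Z_k(t⋆) Z_{k+1}(t⋆)) − ν b^{2k} Z_k(t⋆) = 0`.
In particular, normalising by the peak value `M_k = Z_k(t⋆)`, the lag ratio `σ = Z_{k-1}(t⋆)/M_k` and the catch-up
ratio `ρ = Z_{k+1}(t⋆)/M_k` of an inviscid interior peak satisfy `σ² = b^{5/2} ρ` (census memo, reading (4)).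
[folklore; Fermat] -/
theorem peak_identity {b c₀ ν s : ℝ} {Z : ℤ → ℝ → ℝ}
    (hode : ∀ k : ℕ, ∀ t ∈ Icc 0 s, HasDerivWithinAt (Z k)
      (c₀ * (b ^ ((5 : ℝ) * ((k : ℝ) - 1) / 2) * Z ((k : ℤ) - 1) t ^ 2 -
          b ^ ((5 : ℝ) * (k : ℝ) / 2) * (Z k t * Z ((k : ℤ) + 1) t)) -
        ν * b ^ ((2 : ℝ) * (k : ℝ)) * Z k t) (Icc 0 s) t)
    (k : ℕ) {t : ℝ} (ht : t ∈ Ioo 0 s) (hmax : IsMaxOn (Z k) (Icc 0 s) t) :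
    c₀ * (b ^ ((5 : ℝ) * ((k : ℝ) - 1) / 2) * Z ((k : ℤ) - 1) t ^ 2 -
        b ^ ((5 : ℝ) * (k : ℝ) / 2) * (Z k t * Z ((k : ℤ) + 1) t)) -
      ν * b ^ ((2 : ℝ) * (k : ℝ)) * Z k t = 0 := by
  have hnhds : Icc (0 : ℝ) s ∈ nhds t := Icc_mem_nhds ht.1 ht.2
  have hder : HasDerivAt (Z k) _ t := (hode k t (Ioo_subset_Icc_self ht)).hasDerivAt hnhds
  exact (hmax.isLocalMax hnhds).hasDerivAt_eq_zero hder

/-- **Lag–catch-up contraction at an interior inviscid-or-viscous peak.** If at an interior peak time `t⋆` of the shell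
`k ≥ 1` the previous shell has decayed to at most `σ P`, `P` ITS running peak (`Z_{k-1}(t⋆) ≤ σ P`,
`0 ≤ Z_{k-1}(t⋆)`) and the next shell has caught up to the fraction `ρ > 0` of the present peak (`ρ Z_k(t⋆) ≤ Z_{k+1}(t⋆)`,
`Z_k(t⋆) ≥ 0`), then `b^{5/2} ρ Z_k(t⋆)² ≤ σ² P²` — the per-shell contraction factor of the squared peaks is
`σ²/(b^{5/2}ρ)` (census memo, reading (4): at `b = 1.1` this is `0.89` against the `0.91` required by `θ = 101/200`,
i.e. the two-factor bookkeeping is what a proof below `b ≈ 1.2` must certify). [this file] -/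
theorem sq_peak_le_of_catchup_lag {b c₀ ν s x₀ ρ σ P : ℝ} (hb : 0 < b) (hc₀ : 0 < c₀) (hν : 0 ≤ ν)
    {Z : ℤ → ℝ → ℝ}
    (hdat : ∀ k : ℤ, Z k 0 = if k = 0 then x₀ else 0)
    (hode : ∀ k : ℕ, ∀ t ∈ Icc 0 s, HasDerivWithinAt (Z k)
      (c₀ * (b ^ ((5 : ℝ) * ((k : ℝ) - 1) / 2) * Z ((k : ℤ) - 1) t ^ 2 -
          b ^ ((5 : ℝ) * (k : ℝ) / 2) * (Z k t * Z ((k : ℤ) + 1) t)) -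
        ν * b ^ ((2 : ℝ) * (k : ℝ)) * Z k t) (Icc 0 s) t)
    {k : ℕ} (hk : 1 ≤ k) {t : ℝ} (ht : t ∈ Icc 0 s) (hmax : IsMaxOn (Z k) (Icc 0 s) t)
    (hZk : 0 ≤ Z k t) (hcatch : ρ * Z k t ≤ Z ((k : ℤ) + 1) t)
    (hprev : 0 ≤ Z ((k : ℤ) - 1) t) (hlag : Z ((k : ℤ) - 1) t ≤ σ * P) :
    b ^ ((5 : ℝ) / 2) * ρ * Z k t ^ 2 ≤ σ ^ 2 * P ^ 2 := by
  have h1 := sq_peak_le_of_catchup hb hc₀ hν hdat hode hk ht hmax hZk hcatch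
  have h2 : Z ((k : ℤ) - 1) t ^ 2 ≤ (σ * P) ^ 2 := pow_le_pow_left₀ hprev hlag 2
  calc b ^ ((5 : ℝ) / 2) * ρ * Z k t ^ 2 ≤ Z ((k : ℤ) - 1) t ^ 2 := h1
    _ ≤ (σ * P) ^ 2 := h2
    _ = σ ^ 2 * P ^ 2 := by ring

end Summit.NavierStokesRegularity.NavierStokesRegularity.Theorems.KPChainPeak

end
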